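import Literature.Barriers.AtomisticToContinuum.AnticontinuumLocalization
import Mathlib.Probability.Distributions.Gaussian.Real
import HarnessLib

/-!
# De Roeck–Huveneers 2015, Theorem 1: windows of the chain and window solutions

`Literature/Barriers/AtomisticToContinuum/` — support file for the (future) discharge of the named
fact `DeRoeckHuveneers2015_thm1` (W. De Roeck, F. Huveneers, *Asymptotic localization of energy in
nondisordered oscillator chains*, CPAM **68** (2015), arXiv:1305.5127, Theorem 1 for the rotor
chain), on which the barrier `DeRoeckHuveneers2015_thm2` now solely rests
(`DeRoeckHuveneers2015_thm2_of_thm1_alone`). NO named fact is introduced here.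

## What is here (definitions only; the reduction is proved in the companion files)

* Windows of the `N`-chain around a site `a` (`windowLo`, `windowHi`, `windowSize`, `windowEmb`,
  `windowBond`, `windowProj`): the sites `S = [a - (M+1), a + (M+1)] ∩ [0, N-1]` relabelled by
  `Fin (windowSize a M)`, so that the free rotor chain ON `S` is the rotor chain of length
  `windowSize a M` of the main file, and the restriction map `π : Ω_N → Ω_S`.
* `IsWindowSolution m b γ T ε n M C U G` — the predicate "`(U, G)` is what §5 of the paper
  constructs for the bond `(b, b+1)` of the free chain of length `m`": `U, G` smooth,
  `2π`-angle-periodic, depending only on the sites within distance `M` of `b`, with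
  `ε J_{b,b+1} = L_H U + ε^{n+1} G` identically on `Ω_m`, and admitting MOMENTUM-ONLY measurable
  majorants `|U| ≤ u₀(ω)`, `|∂_♯U| ≤ u₁(ω)`, `|G| ≤ g₀(ω)`, `|∂_♯G| ≤ g₁(ω)` with Gaussian second
  moments `∫u₀² d𝒩(0,T)^{⊗m} ≤ Cε^{1/4}`, `∫u₁² ≤ Cε^{-1/4}`, `∫g₀² ≤ C`, `∫g₁² ≤ C`.

The companion files prove that window solutions for all windows (radius `M = M(γ,T,n)`
independent of the length `m`; `C, ε₀` allowed to depend on the window shape) give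
`DeRoeckHuveneers2015_thm1` for every `N` with `N`-uniform constants
(`AnticontinuumLocalizationThm1Reduction.lean`: transplant `U ∘ π - ⟨U ∘ π⟩_T`, `G ∘ π`).

## Why this is the right interface (§5 of the paper)

The printed proof of Theorem 1 (§5, using §§3–4) constructs, for the bond `(a, a+1)`,
`U_a = H^O_{>a} - H_{>a} - ⟨H^O_{>a} - H_{>a}⟩_T` and `ε^{n+1} G_a = L_H H_{>a}` ((5.9)–(5.10)) out of
the perturbative Hamiltonian `H̃` (§3), the resonance cut-offs `θ_x` (§4) and the partition
`ϑ_{a,x}, ϑ_{a,*}` ((5.2)–(5.3)); §5.3 shows that these objects involve only the variables at sites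
`z` with `|z - a| ≤ n₃ + (n₂ + 5) r` — a radius depending on `n` only — so the construction is the
same on every finite chain containing that window, and the identity
`ε J_{a,a+1} = L_H U_a + ε^{n+1} G_a` only involves the Hamiltonian terms of that window. All four
bounds of (2.8) are obtained in §5.6 and Lemma 4 from pointwise bounds of the form
`|∂ F(q, ω)| ≤ χ_𝖶(ω) · δ^{-k} · p(ω)` (`𝖶` a union of resonance slabs, `p` a polynomial,
(3.12)–(3.13), (5.16)) integrated against the Gaussian momentum marginal of the Gibbs state
((5.17)–(5.19)), i.e. from `ω`-only majorants with controlled Gaussian second moments — the form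
recorded in `IsWindowSolution`. The subtraction of the mean of `U_a` and `⟨G_a⟩_T = 0` ("by
invariance of the Gibbs state", §5.2) are statements about the `N`-chain and belong to the
reduction.

## Design notes

* Majorants are `ℝ≥0∞`-valued and the moment bounds are `lintegral`s (no integrability clause);
  the Gaussian is Mathlib's `gaussianReal 0 T` (variance `T`), the momentum marginal of
  `RotorChain.gibbsMeasure` (`RotorChain.gibbsMeasure_eq_prod`).
* The last site `b = m - 1` carries no bond (`J = 0`) and `U = G = 0` is a window solution
  (`IsWindowSolution.zero`), so the reduction needs no case distinction.
-/
noncomputable section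

open MeasureTheory ProbabilityTheory
open scoped ContDiff ENNReal

namespace Literature.Barriers.AtomisticToContinuum

open Literature.MathematicalPhysics.KineticTheory.HeatConduction HeatConduction HeatConduction.RotorChain

namespace HeatConduction.RotorChain

/-! ### Windows of the chain around a bond

The sites of the `N`-chain within distance `M + 1` of `a`, `S = [a - (M+1), a + (M+1)] ∩ [0, N-1]`,
relabelled by `Fin (windowSize N a M)`; the free rotor chain on `S` is the rotor chain of length
`windowSize N a M` of the main file. -/

variable {N : ℕ}

/-- Left end `lo = max(a - (M+1), 0)` of the window of half-width `M + 1` around `a`. [folklore] -/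
def windowLo (a : Fin N) (M : ℕ) : ℕ := a.val - (M + 1)

/-- Right end `hi = min(a + M + 1, N - 1)` of the window of half-width `M + 1` around `a`. [folklore] -/
def windowHi (a : Fin N) (M : ℕ) : ℕ := min (N - 1) (a.val + (M + 1))

/-- Number of sites `hi - lo + 1` of the window of half-width `M + 1` around `a`. [folklore] -/
def windowSize (a : Fin N) (M : ℕ) : ℕ := windowHi a M + 1 - windowLo a M

/-- `lo ≤ a`. [folklore] -/
theorem windowLo_le (a : Fin N) (M : ℕ) : windowLo a M ≤ a.val := Nat.sub_le _ _

/-- `a ≤ hi`. [folklore] -/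
theorem le_windowHi (a : Fin N) (M : ℕ) : a.val ≤ windowHi a M :=
  le_min (Nat.le_sub_one_of_lt a.isLt) (Nat.le_add_right _ _)

/-- `hi < N`. [folklore] -/
theorem windowHi_lt (a : Fin N) (M : ℕ) : windowHi a M < N :=
  lt_of_le_of_lt (min_le_left _ _) (Nat.sub_one_lt_of_le a.pos le_rfl)

/-- Window sites are sites of the chain: `lo + i < N`. [folklore] -/
theorem windowLo_add_lt_of_lt {a : Fin N} {M : ℕ} {i : ℕ} (hi : i < windowSize a M) :
    windowLo a M + i < N := by
  have h1 := windowLo_le a M; have h2 := le_windowHi a M; have h3 := windowHi_lt a M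
  unfold windowSize at hi
  omega

/-- The window has at most `2M + 3` sites. [folklore] -/
theorem windowSize_le (a : Fin N) (M : ℕ) : windowSize a M ≤ 2 * M + 3 := by
  unfold windowSize windowHi windowLo
  have := min_le_right (N - 1) (a.val + (M + 1))
  omega

/-- The window is nonempty (it contains `a`). [folklore] -/
theorem windowSize_pos (a : Fin N) (M : ℕ) : 0 < windowSize a M := by
  have h1 := windowLo_le a M; have h2 := le_windowHi a M
  unfold windowSize; omega

/-- The relabelling `i ↦ lo + i` of the window sites as sites of the `N`-chain. [folklore] -/
def windowEmb (a : Fin N) (M : ℕ) (i : Fin (windowSize a M)) : Fin N :=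
  ⟨windowLo a M + i.val, windowLo_add_lt_of_lt i.isLt⟩

/-- `windowEmb a M i = lo + i`. [folklore] -/
@[simp] theorem windowEmb_val (a : Fin N) (M : ℕ) (i : Fin (windowSize a M)) :
    (windowEmb a M i).val = windowLo a M + i.val := rfl

/-- The relabelling is injective. [folklore] -/
theorem windowEmb_injective (a : Fin N) (M : ℕ) : Function.Injective (windowEmb a M) := by
  intro i j h
  have := congrArg Fin.val h
  simp only [windowEmb_val] at this
  exact Fin.ext (by omega)

/-- The site `a` seen in the window: `b = a - lo`. [folklore] -/
def windowBond (a : Fin N) (M : ℕ) : Fin (windowSize a M) :=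
  ⟨a.val - windowLo a M, by
    have h1 := windowLo_le a M; have h2 := le_windowHi a M
    unfold windowSize; omega⟩

/-- `windowBond a M = a - lo`. [folklore] -/
@[simp] theorem windowBond_val (a : Fin N) (M : ℕ) : (windowBond a M).val = a.val - windowLo a M := rfl

/-- The window site `b` is the chain site `a`. [folklore] -/
@[simp] theorem windowEmb_windowBond (a : Fin N) (M : ℕ) : windowEmb a M (windowBond a M) = a := by
  apply Fin.ext
  simp only [windowEmb_val, windowBond_val]
  have := windowLo_le a M
  omega

/-- Distances to `b` in the window are distances to `a` in the chain. [folklore] -/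
theorem abs_windowEmb_sub (a : Fin N) (M : ℕ) (i : Fin (windowSize a M)) :
    |((windowEmb a M i).val : ℝ) - a.val| = |(i.val : ℝ) - (windowBond a M).val| := by
  simp only [windowEmb_val, windowBond_val]
  have h := windowLo_le a M
  push_cast [Nat.cast_sub h]
  ring_nf

/-- Restriction of a phase point of the `N`-chain to the window (angles and momenta of the window
sites, relabelled). [folklore] -/
def windowProj (a : Fin N) (M : ℕ) (z : PhaseSpace N) : PhaseSpace (windowSize a M) :=
  (fun i => z.1 (windowEmb a M i), fun i => z.2 (windowEmb a M i))

/-- Angles of the restriction. [folklore] -/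
@[simp] theorem windowProj_fst (a : Fin N) (M : ℕ) (z : PhaseSpace N) (i : Fin (windowSize a M)) :
    (windowProj a M z).1 i = z.1 (windowEmb a M i) := rfl

/-- Momenta of the restriction. [folklore] -/
@[simp] theorem windowProj_snd (a : Fin N) (M : ℕ) (z : PhaseSpace N) (i : Fin (windowSize a M)) :
    (windowProj a M z).2 i = z.2 (windowEmb a M i) := rfl

/-- A window site at most `M` to the right of `b` has a right neighbour in the window iff its
image has one in the chain (the right edge of the window, when cut off by `M`, is at distance
`M + 1` from `b`). [folklore] -/
theorem windowEmb_succ_lt_iff {a : Fin N} {M : ℕ} (i : Fin (windowSize a M))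
    (hi : i.val ≤ (windowBond a M).val + M) :
    (windowEmb a M i).val + 1 < N ↔ i.val + 1 < windowSize a M := by
  have h1 := windowLo_le a M; have h2 := le_windowHi a M; have h3 := windowHi_lt a M
  simp only [windowEmb_val, windowBond_val] at hi ⊢
  unfold windowSize
  unfold windowHi at *
  unfold windowLo at *
  constructor
  · intro h; omega
  · intro h; omega

/-- A window site at most `M` to the left of `b` has a left neighbour in the window iff its image
has one in the chain. [folklore] -/
theorem windowEmb_pos_iff {a : Fin N} {M : ℕ} (i : Fin (windowSize a M))
    (hi : (windowBond a M).val ≤ i.val + M) :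
    0 < (windowEmb a M i).val ↔ 0 < i.val := by
  have h1 := windowLo_le a M
  simp only [windowEmb_val, windowBond_val] at hi ⊢
  unfold windowLo at *
  constructor
  · intro h; omega
  · intro h; omega

/-- Real form of the window distance condition. [folklore] -/
theorem abs_sub_le_natCast_iff (i b M : ℕ) :
    |(i : ℝ) - b| ≤ M ↔ i ≤ b + M ∧ b ≤ i + M := by
  rw [abs_sub_le_iff]
  constructor
  · rintro ⟨h1, h2⟩
    constructor
    · exact_mod_cast (by linarith : (i : ℝ) ≤ b + M)
    · exact_mod_cast (by linarith : (b : ℝ) ≤ i + M)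
  · rintro ⟨h1, h2⟩
    have h1' : (i : ℝ) ≤ b + M := by exact_mod_cast h1
    have h2' : (b : ℝ) ≤ i + M := by exact_mod_cast h2
    constructor <;> linarith

/-- **Window solutions** (the output of §5 of De Roeck–Huveneers for one bond of a finite free
rotor chain). `IsWindowSolution m b γ T ε n M C U G`: on the free rotor chain of length `m`
(coupling `ε`, pinning `γ`), `U, G : Ω_m → ℝ` are smooth, `2π`-periodic in every angle, depend only
on the sites within distance `M` of `b`, satisfy `ε J_{b,b+1} = L_H U + ε^{n+1} G` identically,
and admit momentum-only measurable majorants `|U| ≤ u₀(ω)`, `|∂_♯ U| ≤ u₁(ω)`, `|G| ≤ g₀(ω)`,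
`|∂_♯ G| ≤ g₁(ω)` (all coordinate derivatives `∂_♯`) with
`∫ u₀² d𝒩(0,T)^{⊗m} ≤ C ε^{1/4}`, `∫ u₁² ≤ C ε^{-1/4}`, `∫ g₀² ≤ C`, `∫ g₁² ≤ C`.
[cite: DeRoeckHuveneers2015, §5 ((5.9)–(5.10), §5.3, (5.14)–(5.20), Lemma 4) with §2.3 Thm 1 eq. (2.8)] -/
structure IsWindowSolution (m : ℕ) (b : Fin m) (γ T ε : ℝ) (n M : ℕ) (C : ℝ)
    (U G : PhaseSpace m → ℝ) : Prop where
  contDiff_U : ContDiff ℝ ∞ U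
  contDiff_G : ContDiff ℝ ∞ G
  periodic_U : IsAnglePeriodic m U
  periodic_G : IsAnglePeriodic m G
  local_U : DependsOnlyNear m b M U
  local_G : DependsOnlyNear m b M G
  identity : ∀ z : PhaseSpace m, ε * bondCurrent m b z = liouville m ε γ U z + ε ^ (n + 1) * G z
  bound_U : ∃ u : (Fin m → ℝ) → ℝ≥0∞, Measurable u ∧ (∀ z : PhaseSpace m, ‖U z‖ₑ ≤ u z.2) ∧
    ∫⁻ w, u w ^ 2 ∂(Measure.pi fun _ : Fin m => gaussianReal 0 T.toNNReal) ≤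
      ENNReal.ofReal (C * ε ^ (1 / 4 : ℝ))
  bound_dU : ∃ u : (Fin m → ℝ) → ℝ≥0∞, Measurable u ∧
    (∀ (z : PhaseSpace m) (x : Fin m), ‖partialQ x U z‖ₑ ≤ u z.2 ∧ ‖partialP x U z‖ₑ ≤ u z.2) ∧
    ∫⁻ w, u w ^ 2 ∂(Measure.pi fun _ : Fin m => gaussianReal 0 T.toNNReal) ≤
      ENNReal.ofReal (C * ε ^ (-(1 / 4) : ℝ))
  bound_G : ∃ g : (Fin m → ℝ) → ℝ≥0∞, Measurable g ∧ (∀ z : PhaseSpace m, ‖G z‖ₑ ≤ g z.2) ∧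
    ∫⁻ w, g w ^ 2 ∂(Measure.pi fun _ : Fin m => gaussianReal 0 T.toNNReal) ≤ ENNReal.ofReal C
  bound_dG : ∃ g : (Fin m → ℝ) → ℝ≥0∞, Measurable g ∧
    (∀ (z : PhaseSpace m) (x : Fin m), ‖partialQ x G z‖ₑ ≤ g z.2 ∧ ‖partialP x G z‖ₑ ≤ g z.2) ∧
    ∫⁻ w, g w ^ 2 ∂(Measure.pi fun _ : Fin m => gaussianReal 0 T.toNNReal) ≤ ENNReal.ofReal C

/-- Non-vacuity at the bond-free last site: with `J = 0` there, `U = G = 0` is a window solution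
(majorants `0`, any `C`). [folklore] -/
theorem IsWindowSolution.zero {m : ℕ} (b : Fin m) (hb : m ≤ b.val + 1) (γ T ε : ℝ) (n M : ℕ)
    (C : ℝ) : IsWindowSolution m b γ T ε n M C (fun _ => 0) (fun _ => 0) := by
  have hJ : ∀ z : PhaseSpace m, bondCurrent m b z = 0 := fun z => bondCurrent_eq_zero_of_le b hb z
  have hL : ∀ z : PhaseSpace m, liouville m ε γ (fun _ => (0 : ℝ)) z = 0 := fun z => by
    simp [liouville, partialQ, partialP]
  refine ⟨contDiff_const, contDiff_const, fun _ _ => rfl, fun _ _ => rfl, fun _ _ _ => rfl,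
    fun _ _ _ => rfl, fun z => by rw [hJ, hL]; ring,
    ⟨fun _ => 0, measurable_const, fun z => by simp, by simp⟩,
    ⟨fun _ => 0, measurable_const, fun z x => by constructor <;> simp [partialQ, partialP], by simp⟩,
    ⟨fun _ => 0, measurable_const, fun z => by simp, by simp⟩,
    ⟨fun _ => 0, measurable_const, fun z x => by constructor <;> simp [partialQ, partialP], by simp⟩⟩

/-- The constant `C` of a window solution may be enlarged. [folklore] -/
theorem IsWindowSolution.mono {m : ℕ} {b : Fin m} {γ T ε : ℝ} {n M : ℕ} {C C' : ℝ}
    {U G : PhaseSpace m → ℝ} (h : IsWindowSolution m b γ T ε n M C U G) (hε : 0 ≤ ε) (hCC' : C ≤ C') :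
    IsWindowSolution m b γ T ε n M C' U G := by
  have mono : ∀ {x : ℝ}, 0 ≤ x → ENNReal.ofReal (C * x) ≤ ENNReal.ofReal (C' * x) :=
    fun hx => ENNReal.ofReal_le_ofReal (mul_le_mul_of_nonneg_right hCC' hx)
  obtain ⟨h1, h2, h3, h4, h5, h6, h7, ⟨u₀, hu₀, hU0, hb0⟩, ⟨u₁, hu₁, hU1, hb1⟩, ⟨g₀, hg₀, hG0, hc0⟩,
    ⟨g₁, hg₁, hG1, hc1⟩⟩ := h
  refine ⟨h1, h2, h3, h4, h5, h6, h7, ⟨u₀, hu₀, hU0, hb0.trans (mono (by positivity))⟩,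
    ⟨u₁, hu₁, hU1, hb1.trans (mono (by positivity))⟩, ⟨g₀, hg₀, hG0, hc0.trans ?_⟩,
    ⟨g₁, hg₁, hG1, hc1.trans ?_⟩⟩
  · simpa using (mono zero_le_one)
  · simpa using (mono zero_le_one)

end HeatConduction.RotorChain

end Literature.Barriers.AtomisticToContinuum

end
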